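import Literature.Analysis.FluidPDE.NSCriticalClosureProofs
import Literature.Analysis.FluidPDE.NSCriticalClosureTao
import Literature.Analysis.FluidPDE.NSCriticalClosureBounded
import Literature.Analysis.FluidPDE.NSEssEndpointReduced
import Literature.Analysis.FluidPDE.NSLerayBlowupRateTopHolds
import Literature.Analysis.FluidPDE.KNSSTypeIIHolds
import Literature.Analysis.FluidPDE.TaoLocalisationHolds
import HarnessLib

/-!
# The `L³` continuation criterion, reduced to its single open leaf

Analysis/FluidPDE proof file (theorems only: no definition, no named fact, no statement changed)
on the discharge path of the named fact
`Literature.Analysis.FluidPDE.hasSmoothExtensionPast_of_eLpNorm_three_bounded`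
(`NSCriticalClosure.lean`; Seregin 2012, Thm. 1.1 = the `lim` form of Escauriaza–Seregin–Šverák
2003, Thm. 1.3, read contrapositively: a classical solution of the unforced Navier–Stokes system
on `ℝ³ × [0, T)` which is Leray–Hopf from its rapidly decaying datum and has
`sup_{0 ≤ t < T} ‖u(t)‖_{L³} < ∞` extends as a classical solution past `T`).

The tree holds four accepted assemblies of this fact, each an implication from named facts:

1. `hasSmoothExtensionPast_of_eLpNorm_three_bounded_of_seregin`
   (`NSCriticalClosureProofs.lean`): from `seregin_L3_blowup` (Seregin 2012, Thm. 1.1) and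
   `tao2011_hasBoundedSobolevNormsOn` (Tao 2013, Cor. 11.1 + Cor. 4.3 + Thm. 5.4 (iv));
2. `hasSmoothExtensionPast_of_eLpNorm_three_bounded_of_ess_sup_bound`
   (`NSCriticalClosureProofs.lean`): from `ess_sup_bound` (ESS 2003, §3 (3.5)–(3.6)) and
   `leray_blowup_rate_top` (Leray 1934, §20 (3.9));
3. `hasSmoothExtensionPast_of_eLpNorm_three_bounded_of_ess_tao` (`NSCriticalClosureTao.lean`):
   from `ess_sup_bound` and `tao2011_smooth_local_existence` (Tao 2013, Thm. 5.4 (ii)+(iv));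
4. `hasSmoothExtensionPast_of_eLpNorm_three_bounded_of_ess_bounded`
   (`NSCriticalClosureBounded.lean`): from `ess_sup_bound` and `hasSmoothExtensionPast_of_bounded`
   (Robinson–Rodrigo–Sadowski 2016, Thm. 8.17).

Every *second* input is now a theorem of the tree — `tao2011_hasBoundedSobolevNormsOn_holds`
(`TaoLocalisationHolds.lean`), `leray_blowup_rate_top_holds` (`NSLerayBlowupRateTopHolds.lean`),
`tao2011_smooth_local_existence_holds` (`CheskidovShvydkoyRegularProofs.lean`),
`hasSmoothExtensionPast_of_bounded_holds` (`KNSSTypeIIHolds.lean`) — and so are three of the four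
inputs of ESS (3.5)–(3.6) itself: `ess_sup_bound_of_local_holder` (`NSEssEndpointReduced.lean`:
`ess_local_holder → ess_sup_bound`, the ε-regularity criterion
`lemarieRieusset_epsilon_regularity_holds` and the associated pressure
`ess_associated_pressure_holds` being discharged). This file plugs the discharges in, so that the
kernel certifies the remaining trust base of the fact along each printed line:

* `hasSmoothExtensionPast_of_eLpNorm_three_bounded_of_ess_sup_bound_leray`,
  `…_of_ess_sup_bound_tao`, `…_of_ess_sup_bound_bounded` :
  `ess_sup_bound → hasSmoothExtensionPast_of_eLpNorm_three_bounded` (assemblies 2, 3, 4 closed);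
* `hasSmoothExtensionPast_of_eLpNorm_three_bounded_of_ess_local_holder` :
  `ess_local_holder → hasSmoothExtensionPast_of_eLpNorm_three_bounded` — **the single open leaf on
  the Escauriaza–Seregin–Šverák line is ESS 2003, Thm. 1.4** (local Hölder regularity of
  `L_{3,∞}` suitable pairs on the unit cylinder: blow-up, backward uniqueness in a half-space
  Thm. 5.1, unique continuation Thm. 4.1, the Carleman inequalities of §6);
* `hasSmoothExtensionPast_of_eLpNorm_three_bounded_of_seregin_L3_blowup` :
  `seregin_L3_blowup → hasSmoothExtensionPast_of_eLpNorm_three_bounded` — the single open leaf on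
  Seregin's line is Seregin 2012, Thm. 1.1 itself (assembly 1 closed).

The discharge `hasSmoothExtensionPast_of_eLpNorm_three_bounded_holds` is then the one-line
composition of `…_of_ess_local_holder` with `ess_local_holder_holds` (or of
`…_of_seregin_L3_blowup` with `seregin_L3_blowup_holds`), in a file downstream of that discharge.

## References

* G. Seregin, *A certain necessary condition of potential blow up for Navier–Stokes equations*,
  Comm. Math. Phys. 312 (2012), 833–845 = arXiv:1104.3615, Thm. 1.1 (p. 2). [Seregin2012]
* L. Escauriaza, G. Seregin, V. Šverák, *`L_{3,∞}`-solutions of Navier–Stokes equations and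
  backward uniqueness*, Uspekhi Mat. Nauk 58:2 (2003) 3–44 = Russ. Math. Surveys 58:2 (2003)
  211–250: Thm. 1.3 and its proof in §3 ((3.5)–(3.6)), Thm. 1.4. [EscauriazaSereginSverak2003]
* J. Leray, *Sur le mouvement d'un liquide visqueux emplissant l'espace*, Acta Math. 63 (1934),
  §20 (3.9). [Leray1934]
* T. Tao, *Localisation and compactness properties of the Navier–Stokes global regularity
  problem*, Anal. PDE 6 (2013) 25–107 = arXiv:1108.1165, Thm. 5.4, Cor. 11.1. [Tao2011]
* J. C. Robinson, J. L. Rodrigo, W. Sadowski, *The Three-Dimensional Navier–Stokes Equations*,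
  CUP 2016, Thm. 8.17. [RobinsonRodrigoSadowski2016]
-/

noncomputable section

namespace Literature.Analysis.FluidPDE

/-! ### `ess_sup_bound` alone implies the criterion (assemblies 2, 3, 4 closed) -/

/-- **The `L³` continuation criterion from ESS (3.5)–(3.6) alone, along Leray's rate**
(Escauriaza–Seregin–Šverák 2003, Thm. 1.3 via §3 (3.5)–(3.6); Leray 1934, §20 (3.9)): the
accepted assembly `hasSmoothExtensionPast_of_eLpNorm_three_bounded_of_ess_sup_bound` with its
second input supplied by the theorem `leray_blowup_rate_top_holds`. Real proof.
[cite: EscauriazaSereginSverak2003, Thm. 1.3 with §3 (3.5)–(3.6)] -/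
theorem hasSmoothExtensionPast_of_eLpNorm_three_bounded_of_ess_sup_bound_leray
    (h36 : ess_sup_bound) : hasSmoothExtensionPast_of_eLpNorm_three_bounded :=
  hasSmoothExtensionPast_of_eLpNorm_three_bounded_of_ess_sup_bound h36 leray_blowup_rate_top_holds

/-- **The `L³` continuation criterion from ESS (3.5)–(3.6) alone, along Tao's smooth `H¹` local
theory** (Escauriaza–Seregin–Šverák 2003, Thm. 1.3 via §3 (3.5)–(3.6); Tao 2013, Thm. 5.4
(ii)+(iv)): the accepted assembly `hasSmoothExtensionPast_of_eLpNorm_three_bounded_of_ess_tao`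
with its second input supplied by the theorem `tao2011_smooth_local_existence_holds`. Real proof.
[cite: EscauriazaSereginSverak2003, Thm. 1.3 with §3 (3.5)–(3.6)] -/
theorem hasSmoothExtensionPast_of_eLpNorm_three_bounded_of_ess_sup_bound_tao
    (h36 : ess_sup_bound) : hasSmoothExtensionPast_of_eLpNorm_three_bounded :=
  hasSmoothExtensionPast_of_eLpNorm_three_bounded_of_ess_tao h36 tao2011_smooth_local_existence_holds

/-- **The `L³` continuation criterion from ESS (3.5)–(3.6) alone, along the continuation of
bounded Leray–Hopf solutions** (Escauriaza–Seregin–Šverák 2003, Thm. 1.3 via §3 (3.5)–(3.6): "so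
`T` is not a blow-up time"; Robinson–Rodrigo–Sadowski 2016, Thm. 8.17): the accepted assembly
`hasSmoothExtensionPast_of_eLpNorm_three_bounded_of_ess_bounded` with its second input supplied
by the theorem `hasSmoothExtensionPast_of_bounded_holds`. Real proof.
[cite: EscauriazaSereginSverak2003, Thm. 1.3 with §3 (3.5)–(3.6)] -/
theorem hasSmoothExtensionPast_of_eLpNorm_three_bounded_of_ess_sup_bound_bounded
    (h36 : ess_sup_bound) : hasSmoothExtensionPast_of_eLpNorm_three_bounded :=
  hasSmoothExtensionPast_of_eLpNorm_three_bounded_of_ess_bounded h36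
    hasSmoothExtensionPast_of_bounded_holds

/-! ### The single open leaves -/

/-- **The `L³` continuation criterion from ESS Theorem 1.4 alone** (Escauriaza–Seregin–Šverák
2003, Thm. 1.3, proved in §3 from Thm. 1.4; Seregin 2012, Thm. 1.1 for the `lim` sharpening,
which is not needed under the uniform bound `sup_{[0,T)} ‖u(t)‖₃ < ∞`): the local Hölder
regularity of `L_{3,∞}` suitable pairs (`ess_local_holder`) implies the criterion, ESS
(3.5)–(3.6) following from it by the theorem `ess_sup_bound_of_local_holder` (ε-regularity and
the associated pressure discharged) and the continuation step by
`hasSmoothExtensionPast_of_eLpNorm_three_bounded_of_ess_sup_bound_leray`. Real proof; the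
discharge of the fact is this theorem applied to `ess_local_holder_holds` once ESS Thm. 1.4 is
proved. [cite: EscauriazaSereginSverak2003, Thm. 1.3–1.4, §3 (3.5)–(3.6)] -/
theorem hasSmoothExtensionPast_of_eLpNorm_three_bounded_of_ess_local_holder
    (hLH : ess_local_holder) : hasSmoothExtensionPast_of_eLpNorm_three_bounded :=
  hasSmoothExtensionPast_of_eLpNorm_three_bounded_of_ess_sup_bound_leray
    (ess_sup_bound_of_local_holder hLH)

/-- **The `L³` continuation criterion from Seregin's blow-up criterion alone** (Seregin 2012,
Thm. 1.1, contrapositive: "Let `T > 0` be a finite blow up time. Then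
`lim_{t → T-0} ‖v(·, t)‖₃ = ∞`"): the accepted assembly
`hasSmoothExtensionPast_of_eLpNorm_three_bounded_of_seregin` with the boundedness on closed
sub-strips supplied by the theorem `tao2011_hasBoundedSobolevNormsOn_holds` (Tao 2013, Cor. 11.1
with Cor. 4.3 and Thm. 5.4 (iv), and the Sobolev imbedding). Real proof.
[cite: Seregin2012, Thm. 1.1] -/
theorem hasSmoothExtensionPast_of_eLpNorm_three_bounded_of_seregin_L3_blowup
    (hS : seregin_L3_blowup) : hasSmoothExtensionPast_of_eLpNorm_three_bounded :=
  hasSmoothExtensionPast_of_eLpNorm_three_bounded_of_seregin hS tao2011_hasBoundedSobolevNormsOn_holds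

/-- **Dependency record.** The fact holds as soon as either open leaf is discharged: ESS 2003,
Thm. 1.4 (`ess_local_holder`) or Seregin 2012, Thm. 1.1 (`seregin_L3_blowup`).
[cite: Seregin2012, Thm. 1.1] [cite: EscauriazaSereginSverak2003, Thm. 1.4] -/
theorem hasSmoothExtensionPast_of_eLpNorm_three_bounded_of_or
    (h : ess_local_holder ∨ seregin_L3_blowup) : hasSmoothExtensionPast_of_eLpNorm_three_bounded :=
  h.elim hasSmoothExtensionPast_of_eLpNorm_three_bounded_of_ess_local_holder
    hasSmoothExtensionPast_of_eLpNorm_three_bounded_of_seregin_L3_blowup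

end Literature.Analysis.FluidPDE

end
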